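import Literature.RepresentationTheory.Kovacevic2021.SU21ArrowReversal
import Literature.RepresentationTheory.Kovacevic2021.SU21Casimir
import HarnessLib

/-!
# Vertex rigidity of Kovačević's `K`-type data for `SU(2,1)`: the cone lemma, the vertex equation,
# and unique continuation from the vertex

Continuation of `Literature.RepresentationTheory.Kovacevic2021.SU21ArrowReversal` (live walks in a datum
`𝒟 : SU21Datum` can be sorted; under strong connectivity adjacent `K`-types are linked both ways) and
`SU21Casimir` (the Casimir acts on `V_{n,m}` by `casimirScalar n m`).  This file supplies the three
structural steps of the classification of the cohomological data
(`Literature.RepresentationTheory.Kovacevic2021.SU21CohomologicalClassification`, Borel–Wallach VI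
Thm 4.11 (1) for `SU(2,1)` at the level of `K`-type data):

* **Cone lemma** (`le_of_reach_of_notMem_D`, `le_of_reach_of_notMem_C`): if the `K`-type `x = (n,m)` has
  no `K`-type at its lower neighbour `x + D = (n-1, m-3)` (resp. `x + C = (n-1, m+3)`), then along every
  live walk out of `x` the linear form `3n + m` (resp. `3n - m`) does not decrease — a sorted walk
  (`sorted_of_reach`) cannot begin with a `D`-step, and the remaining directions do not lower the form.
  Hence (`eq_of_isLocalMin`) a strongly connected datum has at most ONE local minimum (a `K`-type with
  no `K`-type at either lower neighbour), all of `S` lies in the cone `n - n₀ ≥ |m - m₀|/3` above it, and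
  every other `K`-type has a lower neighbour joined to it by a live edge (`exists_lower_of_ne`).
* **Vertex equation** (`vertex_eq`): at a local minimum `(n₀, m₀)` the relations (b20), (b25) of
  [Kovacevic2021, Thm 2] have no lower terms; if the Casimir scalar vanishes there, then `n₀ = 1` or
  `m₀² = 3(n₀+1)(3-n₀)`, i.e. `(n₀,m₀) ∈ {(2,3), (2,-3), (3,0)}`.
* **Unique continuation** (`mem_iff_and_products_eq_of_vertex`): two data containing the same vertex
  `x₀`, each generated downward to `x₀` (every `K`-type `≠ x₀` has a lower neighbour joined by a live
  edge) and with vanishing Casimir scalar on the level `n = 1`, have the same `K`-types and the same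
  gauge-invariant products `A_{n,m}D_{n+1,m+3}`, `B_{n,m}C_{n+1,m-3}` [Kovacevic2021, Remark 3] — by
  induction on the level `n`, solving (b20), (b25) (a Cramer system with determinant `n² - 1`) for the
  two upward products, and (b20) together with `Ω = 0` on the level `n = 1`.

Sources: [Kovacevic2021, §3 Thm 2 and its proof, Remark 3, proof of Thm 3 (the walk / cone argument),
held text `paper:arxiv-1810.01752` p0006–p0008]; [BorelWallach2000, VI 4.8–4.11 pp. 131–132] for the
role of these facts.  The source asserts the reconstruction of an irreducible module from its `K`-types
and (b20)–(b45) (Thm 2, last sentence) without proof; the statements here are the rigorous form we need.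

## What is here (theorems only; no definitions, no named facts)

`le_of_reach_of_notMem_D`, `le_of_reach_of_notMem_C`, `cone_of_isLocalMin`, `eq_of_isLocalMin`,
`exists_lower_of_ne`, `exists_isLocalMin`, `reach_lattice`, `vertex_eq`,
`casimirScalar_eq_zero_of_casimir_eq_zero`, `mem_iff_and_products_eq_of_vertex`.

## References

* D. Kovačević, *Unitary `(𝔤,K)` modules of `SU(2,1)`*, Acta Math. Spalatensia 1 (2021) 105–125
  (arXiv:1810.01752): §3 Thm 2, Remark 3, Thm 3. [Kovacevic2021]
* A. Borel, N. Wallach (2000), VI 4.8–4.11 pp. 131–132. [BorelWallach2000]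
-/

namespace Literature.RepresentationTheory.Kovacevic2021

namespace SU21Datum

variable {𝒟 : SU21Datum}

/-! ## §1 The cone lemma and local minima -/

/-- along a live walk avoiding the direction `D` the form `3n + m` does not decrease [folklore] -/
private theorem le_of_freeReach_D {x y : ℤ × ℤ} (h : 𝒟.FreeReach Dir.D x y) :
    3 * x.1 + x.2 ≤ 3 * y.1 + y.2 := by
  induction h with
  | refl => exact le_rfl
  | tail _ hst ih =>
    obtain ⟨σ, hσ, hstep⟩ := hst
    rw [hstep.tgt_eq]
    refine ih.trans ?_
    cases σ <;> simp only [Dir.shift] <;> first | omega | exact absurd rfl hσ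

/-- along a live walk avoiding the direction `C` the form `3n - m` does not decrease [folklore] -/
private theorem le_of_freeReach_C {x y : ℤ × ℤ} (h : 𝒟.FreeReach Dir.C x y) :
    3 * x.1 - x.2 ≤ 3 * y.1 - y.2 := by
  induction h with
  | refl => exact le_rfl
  | tail _ hst ih =>
    obtain ⟨σ, hσ, hstep⟩ := hst
    rw [hstep.tgt_eq]
    refine ih.trans ?_
    cases σ <;> simp only [Dir.shift] <;> first | omega | exact absurd rfl hσ

/-- **Cone lemma, `D`-side.** If `x = (n,m)` has no `K`-type at `(n-1, m-3)`, then `3n + m` does not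
decrease along any live walk out of `x` (sort the walk with respect to `D`: it cannot start with a
`D`-step). [cite: Kovacevic2021, §3 proof of Thm 3 ("walk from one vertex to another")] -/
theorem le_of_reach_of_notMem_D {x y : ℤ × ℤ} (hx : (x.1 - 1, x.2 - 3) ∉ 𝒟.S) (h : 𝒟.Reach x y) :
    3 * x.1 + x.2 ≤ 3 * y.1 + y.2 := by
  obtain ⟨j, hsteps, hfree⟩ := sorted_of_reach Dir.D h
  rcases Nat.eq_zero_or_pos j with rfl | hj
  · rw [Dir.shiftN_zero] at hfree
    exact le_of_freeReach_D hfree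
  · have h0 := hsteps 0 hj
    rw [Dir.shiftN_zero, Dir.shiftN_one] at h0
    have ht : Dir.D.shift x ∈ 𝒟.S := h0.tgt_mem
    exact absurd ht hx

/-- **Cone lemma, `C`-side.** If `x = (n,m)` has no `K`-type at `(n-1, m+3)`, then `3n - m` does not
decrease along any live walk out of `x`. [cite: Kovacevic2021, §3 proof of Thm 3] -/
theorem le_of_reach_of_notMem_C {x y : ℤ × ℤ} (hx : (x.1 - 1, x.2 + 3) ∉ 𝒟.S) (h : 𝒟.Reach x y) :
    3 * x.1 - x.2 ≤ 3 * y.1 - y.2 := by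
  obtain ⟨j, hsteps, hfree⟩ := sorted_of_reach Dir.C h
  rcases Nat.eq_zero_or_pos j with rfl | hj
  · rw [Dir.shiftN_zero] at hfree
    exact le_of_freeReach_C hfree
  · have h0 := hsteps 0 hj
    rw [Dir.shiftN_zero, Dir.shiftN_one] at h0
    have ht : Dir.C.shift x ∈ 𝒟.S := h0.tgt_mem
    exact absurd ht hx

/-- **The cone above a local minimum.** If `x = (n₀,m₀) ∈ S` is a local minimum (no `K`-type at
`(n₀-1, m₀∓3)`), every `K`-type `y = (n,m)` reachable from `x` satisfies `3(n-n₀) ≥ |m-m₀|`.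
[cite: Kovacevic2021, §3 proof of Thm 3, §4 (the cones `W(r,s)`)] -/
theorem cone_of_isLocalMin {x y : ℤ × ℤ} (hD : (x.1 - 1, x.2 - 3) ∉ 𝒟.S) (hC : (x.1 - 1, x.2 + 3) ∉ 𝒟.S)
    (h : 𝒟.Reach x y) : 3 * x.1 + x.2 ≤ 3 * y.1 + y.2 ∧ 3 * x.1 - x.2 ≤ 3 * y.1 - y.2 :=
  ⟨le_of_reach_of_notMem_D hD h, le_of_reach_of_notMem_C hC h⟩

/-- **A strongly connected datum has at most one local minimum.** [cite: Kovacevic2021, §3 proof of Thm 3] -/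
theorem eq_of_isLocalMin (hconn : ∀ x ∈ 𝒟.S, ∀ y ∈ 𝒟.S, 𝒟.Reach x y) {x y : ℤ × ℤ} (hx : x ∈ 𝒟.S)
    (hy : y ∈ 𝒟.S) (hxD : (x.1 - 1, x.2 - 3) ∉ 𝒟.S) (hxC : (x.1 - 1, x.2 + 3) ∉ 𝒟.S)
    (hyD : (y.1 - 1, y.2 - 3) ∉ 𝒟.S) (hyC : (y.1 - 1, y.2 + 3) ∉ 𝒟.S) : x = y := by
  obtain ⟨h1, h2⟩ := cone_of_isLocalMin hxD hxC (hconn x hx y hy)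
  obtain ⟨h3, h4⟩ := cone_of_isLocalMin hyD hyC (hconn y hy x hx)
  exact Prod.ext (by omega) (by omega)

/-- **Every `K`-type other than the local minimum has a lower neighbour joined by a live edge** (in a
strongly connected datum with a local minimum `x₀`): `A_{n-1,m-3} D_{n,m} ≠ 0` or `B_{n-1,m+3} C_{n,m} ≠ 0`.
[cite: Kovacevic2021, §3 proof of Thm 2, proof of Thm 3] -/
theorem exists_lower_of_ne (hconn : ∀ x ∈ 𝒟.S, ∀ y ∈ 𝒟.S, 𝒟.Reach x y) {x₀ : ℤ × ℤ} (h₀ : x₀ ∈ 𝒟.S)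
    (h₀D : (x₀.1 - 1, x₀.2 - 3) ∉ 𝒟.S) (h₀C : (x₀.1 - 1, x₀.2 + 3) ∉ 𝒟.S) {n m : ℤ}
    (hy : (n, m) ∈ 𝒟.S) (hne : (n, m) ≠ x₀) :
    𝒟.A (n - 1) (m - 3) * 𝒟.D n m ≠ 0 ∨ 𝒟.B (n - 1) (m + 3) * 𝒟.C n m ≠ 0 := by
  by_cases hD : (n - 1, m - 3) ∈ 𝒟.S
  · left
    have h' : (n - 1 + 1, m - 3 + 3) ∈ 𝒟.S := by simpa only [sub_add_cancel] using hy
    have := (A_mul_D_ne_zero_iff hconn hD).2 h'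
    simpa only [sub_add_cancel] using this
  by_cases hC : (n - 1, m + 3) ∈ 𝒟.S
  · right
    have h' : (n - 1 + 1, m + 3 - 3) ∈ 𝒟.S := by simpa only [sub_add_cancel, add_sub_cancel_right] using hy
    have := (B_mul_C_ne_zero_iff hconn hC).2 h'
    simpa only [sub_add_cancel, add_sub_cancel_right] using this
  exact absurd (eq_of_isLocalMin hconn hy h₀ hD hC h₀D h₀C) hne

/-- **A non-empty datum has a local minimum**: a `K`-type of least dimension `n`.
[cite: Kovacevic2021, §3 Def 1 (`n ≥ 1`)] -/
theorem exists_isLocalMin (hne : 𝒟.S.Nonempty) :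
    ∃ x₀ ∈ 𝒟.S, (x₀.1 - 1, x₀.2 - 3) ∉ 𝒟.S ∧ (x₀.1 - 1, x₀.2 + 3) ∉ 𝒟.S ∧ ∀ y ∈ 𝒟.S, x₀.1 ≤ y.1 := by
  obtain ⟨n₀, ⟨m₀, h₀⟩, hmin⟩ := Int.exists_least_of_bdd (P := fun n => ∃ m, (n, m) ∈ 𝒟.S)
    ⟨1, fun n ⟨m, h⟩ => 𝒟.one_le_of_mem h⟩ (let ⟨⟨n, m⟩, h⟩ := hne; ⟨n, m, h⟩)
  refine ⟨(n₀, m₀), h₀, fun h => ?_, fun h => ?_, fun y hy => hmin y.1 ⟨y.2, hy⟩⟩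
  · have := hmin (n₀ - 1) ⟨m₀ - 3, h⟩; omega
  · have := hmin (n₀ - 1) ⟨m₀ + 3, h⟩; omega

/-- **The lattice of the six `F`-labels is preserved by live steps**: if `x = (1+p+q, 3p-3q)` for some
`p, q ∈ ℤ`, so is every `K`-type reachable from `x` (each arrow changes `(n, m)` by `(±1, ±3)`).
[cite: Kovacevic2021, §3 Thm 1] -/
theorem reach_lattice {x y : ℤ × ℤ} (h : 𝒟.Reach x y) (hx : ∃ p q : ℤ, x = (1 + p + q, 3 * p - 3 * q)) :
    ∃ p q : ℤ, y = (1 + p + q, 3 * p - 3 * q) := by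
  induction h with
  | refl => exact hx
  | tail _ hst ih =>
    obtain ⟨p, q, hb⟩ := ih
    obtain ⟨δ, hstep⟩ := hst
    rw [hstep.tgt_eq, hb]
    cases δ
    · exact ⟨p + 1, q, by simp only [Dir.shift, Prod.mk.injEq]; constructor <;> ring⟩
    · exact ⟨p, q + 1, by simp only [Dir.shift, Prod.mk.injEq]; constructor <;> ring⟩
    · exact ⟨p, q - 1, by simp only [Dir.shift, Prod.mk.injEq]; constructor <;> ring⟩
    · exact ⟨p - 1, q, by simp only [Dir.shift, Prod.mk.injEq]; constructor <;> ring⟩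

/-! ## §2 The vertex equation -/

/-- **Vertex equation.** At a local minimum `(n₀,m₀)` (no `K`-type at `(n₀-1, m₀∓3)`) the relations (b20),
(b25) read `-P + n₀Q = (m₀-n₀+1)/2`, `-n₀P + Q = (m₀+n₀-1)/2` for the two upward products
`P = A D'`, `Q = B C'`; if `n₀ ≥ 2` this gives `P + Q = -1`, and `Ω = 0` then forces
`m₀² = 3(n₀+1)(3-n₀)`, i.e. `(n₀,m₀) ∈ {(2,3),(2,-3),(3,0)}`.
[cite: Kovacevic2021, §3 Thm 2 (b20), (b25), Thm 3 (b65)–(b80)] [cite: BorelWallach2000, VI Thm 4.11 (1)] -/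
theorem vertex_eq {n m : ℤ} (hS : (n, m) ∈ 𝒟.S) (hD : (n - 1, m - 3) ∉ 𝒟.S) (hC : (n - 1, m + 3) ∉ 𝒟.S)
    (hcas : 𝒟.casimirScalar n m = 0) :
    n = 1 ∨ (n = 2 ∧ (m = 3 ∨ m = -3)) ∨ (n = 3 ∧ m = 0) := by
  have hn : 1 ≤ n := 𝒟.one_le_of_mem hS
  rcases eq_or_lt_of_le hn with h1 | h1
  · exact Or.inl h1.symm
  right
  have hA : 𝒟.A (n - 1) (m - 3) = 0 := 𝒟.A_eq_zero hD
  have hB : 𝒟.B (n - 1) (m + 3) = 0 := 𝒟.B_eq_zero hC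
  have e1 := 𝒟.rel20 hS
  have e2 := 𝒟.rel25 hS
  rw [casimirScalar] at hcas
  have hn1 : (n : ℂ) - 1 ≠ 0 := by
    have : (n - 1 : ℤ) ≠ 0 := by omega
    exact_mod_cast this
  have hsum : 𝒟.A n m * 𝒟.D (n + 1) (m + 3) + 𝒟.B n m * 𝒟.C (n + 1) (m - 3) = -1 := by
    apply mul_left_cancel₀ hn1
    linear_combination e1 - e2 + ((n : ℂ) - 1) * 𝒟.C n m * hB + ((n : ℂ) - 1) * 𝒟.D n m * hA
  have key : ((m : ℂ)) ^ 2 = 3 * ((n : ℂ) + 1) * (3 - n) := by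
    linear_combination 6 * hcas - 6 * ((n : ℂ) + 1) * hsum
      - 6 * ((n : ℂ) - 1) * 𝒟.D n m * hA - 6 * ((n : ℂ) - 1) * 𝒟.C n m * hB
  have keyZ : m ^ 2 = 3 * (n + 1) * (3 - n) := by exact_mod_cast key
  rcases le_or_gt n 3 with hn3 | hn3
  · interval_cases n
    · refine Or.inl ⟨rfl, ?_⟩
      have h9 : (m - 3) * (m + 3) = 0 := by linear_combination keyZ
      rcases mul_eq_zero.1 h9 with h | h
      · left; omega
      · right; omega
    · refine Or.inr ⟨rfl, ?_⟩
      have h0 : m ^ 2 = 0 := by linear_combination keyZ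
      exact (pow_eq_zero_iff two_ne_zero).1 h0
  · exfalso
    nlinarith [sq_nonneg m, mul_nonneg (show (0 : ℤ) ≤ n - 4 by omega) (show (0 : ℤ) ≤ n + 1 by omega)]

/-- `Ω = 0` as an operator gives `casimirScalar n m = 0` on every `K`-type (`Ω u^1_{n,m} = c_{n,m} u^1_{n,m}`).
[cite: BorelWallach2000, II §2.5] [cite: Kovacevic2021, §3 Thm 1] -/
theorem casimirScalar_eq_zero_of_casimir_eq_zero (h : 𝒟.casimir = 0) {n m : ℤ} (hS : (n, m) ∈ 𝒟.S) :
    𝒟.casimirScalar n m = 0 := by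
  have h1 := 𝒟.casimir_vec hS le_rfl (𝒟.one_le_of_mem hS)
  rw [h, LinearMap.zero_apply] at h1
  exact (smul_eq_zero.1 h1.symm).resolve_right (𝒟.vec_ne_zero ⟨hS, le_rfl, 𝒟.one_le_of_mem hS⟩)

/-! ## §3 Unique continuation from the vertex -/

section Continuation

variable {𝒟₁ 𝒟₂ : SU21Datum} {x₀ : ℤ × ℤ}

/-- membership transfer at one level, given the products one level down [cite: Kovacevic2021, §3 Thm 2] -/
private theorem mem_of_mem_of_lower (h₂ : x₀ ∈ 𝒟₂.S)
    (hdown₁ : ∀ n m : ℤ, (n, m) ∈ 𝒟₁.S → (n, m) ≠ x₀ →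
      𝒟₁.A (n - 1) (m - 3) * 𝒟₁.D n m ≠ 0 ∨ 𝒟₁.B (n - 1) (m + 3) * 𝒟₁.C n m ≠ 0)
    {n m : ℤ}
    (hP : 𝒟₁.A (n - 1) (m - 3) * 𝒟₁.D n m = 𝒟₂.A (n - 1) (m - 3) * 𝒟₂.D n m)
    (hQ : 𝒟₁.B (n - 1) (m + 3) * 𝒟₁.C n m = 𝒟₂.B (n - 1) (m + 3) * 𝒟₂.C n m)
    (hS : (n, m) ∈ 𝒟₁.S) : (n, m) ∈ 𝒟₂.S := by
  by_cases hx : (n, m) = x₀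
  · rw [hx]; exact h₂
  rcases hdown₁ n m hS hx with h | h
  · rw [hP] at h
    by_contra hS₂
    exact h (by rw [𝒟₂.D_eq_zero hS₂, mul_zero])
  · rw [hQ] at h
    by_contra hS₂
    exact h (by rw [𝒟₂.C_eq_zero hS₂, mul_zero])

/-- **Unique continuation from the vertex.** Let `𝒟₁`, `𝒟₂` be two data containing `x₀`, each generated
downward to `x₀` (every `K`-type `(n,m) ≠ x₀` has `A_{n-1,m-3}D_{n,m} ≠ 0` or `B_{n-1,m+3}C_{n,m} ≠ 0`) and
with Casimir scalar `0` on the level `n = 1`.  Then `𝒟₁.S = 𝒟₂.S` and the gauge-invariant products agree: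
`A₁D₁' = A₂D₂'`, `B₁C₁' = B₂C₂'` everywhere.  (Induction on `n`: the upward products at a `K`-type are the
unique solution of (b20), (b25) — resp. of (b20) and `Ω = 0` on the level `n = 1` — given the downward ones.)
[cite: Kovacevic2021, §3 Thm 2 (last sentence: "it is possible to reconstruct"), Remark 3] -/
theorem mem_iff_and_products_eq_of_vertex (h₁ : x₀ ∈ 𝒟₁.S) (h₂ : x₀ ∈ 𝒟₂.S)
    (hdown₁ : ∀ n m : ℤ, (n, m) ∈ 𝒟₁.S → (n, m) ≠ x₀ →
      𝒟₁.A (n - 1) (m - 3) * 𝒟₁.D n m ≠ 0 ∨ 𝒟₁.B (n - 1) (m + 3) * 𝒟₁.C n m ≠ 0)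
    (hdown₂ : ∀ n m : ℤ, (n, m) ∈ 𝒟₂.S → (n, m) ≠ x₀ →
      𝒟₂.A (n - 1) (m - 3) * 𝒟₂.D n m ≠ 0 ∨ 𝒟₂.B (n - 1) (m + 3) * 𝒟₂.C n m ≠ 0)
    (hcas₁ : ∀ m : ℤ, ((1 : ℤ), m) ∈ 𝒟₁.S → 𝒟₁.casimirScalar 1 m = 0)
    (hcas₂ : ∀ m : ℤ, ((1 : ℤ), m) ∈ 𝒟₂.S → 𝒟₂.casimirScalar 1 m = 0) (n m : ℤ) :
    ((n, m) ∈ 𝒟₁.S ↔ (n, m) ∈ 𝒟₂.S) ∧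
      𝒟₁.A n m * 𝒟₁.D (n + 1) (m + 3) = 𝒟₂.A n m * 𝒟₂.D (n + 1) (m + 3) ∧
      𝒟₁.B n m * 𝒟₁.C (n + 1) (m - 3) = 𝒟₂.B n m * 𝒟₂.C (n + 1) (m - 3) := by
  -- the claim for non-`K`-types
  have triv : ∀ n m : ℤ, (n, m) ∉ 𝒟₁.S → (n, m) ∉ 𝒟₂.S →
      ((n, m) ∈ 𝒟₁.S ↔ (n, m) ∈ 𝒟₂.S) ∧
        𝒟₁.A n m * 𝒟₁.D (n + 1) (m + 3) = 𝒟₂.A n m * 𝒟₂.D (n + 1) (m + 3) ∧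
        𝒟₁.B n m * 𝒟₁.C (n + 1) (m - 3) = 𝒟₂.B n m * 𝒟₂.C (n + 1) (m - 3) := by
    intro n m hn₁ hn₂
    refine ⟨⟨fun h => absurd h hn₁, fun h => absurd h hn₂⟩, ?_, ?_⟩
    · rw [𝒟₁.A_eq_zero hn₁, 𝒟₂.A_eq_zero hn₂, zero_mul, zero_mul]
    · rw [𝒟₁.B_eq_zero hn₁, 𝒟₂.B_eq_zero hn₂, zero_mul, zero_mul]
  -- induction on the level `n`
  suffices main : ∀ N : ℕ, ∀ n m : ℤ, n ≤ N →
      ((n, m) ∈ 𝒟₁.S ↔ (n, m) ∈ 𝒟₂.S) ∧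
        𝒟₁.A n m * 𝒟₁.D (n + 1) (m + 3) = 𝒟₂.A n m * 𝒟₂.D (n + 1) (m + 3) ∧
        𝒟₁.B n m * 𝒟₁.C (n + 1) (m - 3) = 𝒟₂.B n m * 𝒟₂.C (n + 1) (m - 3) from
    main n.toNat n m (Int.self_le_toNat n)
  intro N
  induction N with
  | zero =>
    intro n m hn
    exact triv n m (fun h => by have := 𝒟₁.one_le_of_mem h; omega)
      (fun h => by have := 𝒟₂.one_le_of_mem h; omega)
  | succ N ih =>
    intro n m hn
    rcases (show n ≤ (N : ℤ) ∨ n = N + 1 by omega) with hle | hN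
    · exact ih n m hle
    -- the products on the two lower edges agree, by induction
    have hP : 𝒟₁.A (n - 1) (m - 3) * 𝒟₁.D n m = 𝒟₂.A (n - 1) (m - 3) * 𝒟₂.D n m := by
      have := (ih (n - 1) (m - 3) (by omega)).2.1
      simpa only [sub_add_cancel] using this
    have hQ : 𝒟₁.B (n - 1) (m + 3) * 𝒟₁.C n m = 𝒟₂.B (n - 1) (m + 3) * 𝒟₂.C n m := by
      have := (ih (n - 1) (m + 3) (by omega)).2.2
      simpa only [sub_add_cancel, add_sub_cancel_right] using this
    have hiff : (n, m) ∈ 𝒟₁.S ↔ (n, m) ∈ 𝒟₂.S :=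
      ⟨mem_of_mem_of_lower h₂ hdown₁ hP hQ, mem_of_mem_of_lower h₁ hdown₂ hP.symm hQ.symm⟩
    by_cases hS₁ : (n, m) ∈ 𝒟₁.S
    swap
    · exact triv n m hS₁ (fun h => hS₁ (hiff.2 h))
    have hS₂ : (n, m) ∈ 𝒟₂.S := hiff.1 hS₁
    refine ⟨hiff, ?_⟩
    -- the relations at `(n, m)` for both data, with equal lower products
    have hP' : 𝒟₁.D n m * 𝒟₁.A (n - 1) (m - 3) = 𝒟₂.D n m * 𝒟₂.A (n - 1) (m - 3) := by
      rw [mul_comm, hP, mul_comm]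
    have hQ' : 𝒟₁.C n m * 𝒟₁.B (n - 1) (m + 3) = 𝒟₂.C n m * 𝒟₂.B (n - 1) (m + 3) := by
      rw [mul_comm, hQ, mul_comm]
    have e1₁ := 𝒟₁.rel20 hS₁
    have e1₂ := 𝒟₂.rel20 hS₂
    have e2₁ := 𝒟₁.rel25 hS₁
    have e2₂ := 𝒟₂.rel25 hS₂
    have hn1 : 1 ≤ n := 𝒟₁.one_le_of_mem hS₁
    rcases eq_or_lt_of_le hn1 with hn | hn
    · -- level `n = 1`: (b20) and `Ω = 0`
      subst hn
      have hc₁ := hcas₁ m hS₁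
      have hc₂ := hcas₂ m hS₂
      rw [casimirScalar] at hc₁ hc₂
      rw [Int.cast_one] at e1₁ e1₂ hc₁ hc₂
      constructor
      · linear_combination (-1 / 2 : ℂ) * (e1₁ - e1₂) + (1 / 4 : ℂ) * (hc₁ - hc₂)
      · linear_combination (1 / 2 : ℂ) * (e1₁ - e1₂) + (1 / 4 : ℂ) * (hc₁ - hc₂)
    · -- level `n ≥ 2`: Cramer on (b20), (b25)
      have d1 : -(𝒟₁.A n m * 𝒟₁.D (n + 1) (m + 3) - 𝒟₂.A n m * 𝒟₂.D (n + 1) (m + 3))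
          + (n : ℂ) * (𝒟₁.B n m * 𝒟₁.C (n + 1) (m - 3) - 𝒟₂.B n m * 𝒟₂.C (n + 1) (m - 3)) = 0 := by
        linear_combination e1₁ - e1₂ + ((n : ℂ) - 1) * hQ'
      have d2 : -(n : ℂ) * (𝒟₁.A n m * 𝒟₁.D (n + 1) (m + 3) - 𝒟₂.A n m * 𝒟₂.D (n + 1) (m + 3))
          + (𝒟₁.B n m * 𝒟₁.C (n + 1) (m - 3) - 𝒟₂.B n m * 𝒟₂.C (n + 1) (m - 3)) = 0 := by
        linear_combination e2₁ - e2₂ - ((n : ℂ) - 1) * hP'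
      have hdet : ((n : ℂ) ^ 2 - 1) ≠ 0 := by
        have : (n ^ 2 - 1 : ℤ) ≠ 0 := by nlinarith
        exact_mod_cast this
      have d3 : ((n : ℂ) ^ 2 - 1) * (𝒟₁.A n m * 𝒟₁.D (n + 1) (m + 3) - 𝒟₂.A n m * 𝒟₂.D (n + 1) (m + 3)) = 0 := by
        linear_combination d1 - (n : ℂ) * d2
      have hA : 𝒟₁.A n m * 𝒟₁.D (n + 1) (m + 3) = 𝒟₂.A n m * 𝒟₂.D (n + 1) (m + 3) := by
        have := (mul_eq_zero.1 d3).resolve_left hdet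
        exact sub_eq_zero.1 this
      refine ⟨hA, ?_⟩
      linear_combination d2 + (n : ℂ) * hA

end Continuation

end SU21Datum

end Literature.RepresentationTheory.Kovacevic2021
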